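import Literature.NumberTheory.Automorphic.ArchLocalWallFibreUnfolding            -- ★ p840556: brings `endoForm`, `archLocal`, the block groups
import Mathlib.Analysis.Calculus.ParametricIntegral
import Mathlib.Analysis.Calculus.FDeriv.Mul
import Mathlib.Analysis.Matrix.Normed
import Mathlib.MeasureTheory.Integral.Bochner.Set
import HarnessLib

/-!
# THE AVERAGED 2×2 TEST FUNCTION `f♭(X) = ∫_{G_w} β(g) Θ(↑↑g · endoForm X D · ↑↑g⁻¹) dν(g)` is `C¹` with compact support (ROAD-Sd, in-house road to the letter (J-nc), step (d3a-II);
# differentiation under the integral sign, Folland 1995 Thm. 2.27)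

Topic `NumberTheory/Automorphic`; namespaces `Literature.NumberTheory.Automorphic` (§1, generic) and `….UnitaryGroup` (§2).  THEOREMS ONLY (no `def`, no instance, no notation, no
axiom, no named fact, no `sorry`).  Cell `pub/hodgecm-mathlib`, ENGINE T1 (crux H413 = `stmt-HodgeConjecture-24833`); floor-1∕2 preparation, count-neutral, under books rows #111 (S-d) ∕
#88 (ST-∞), PLAN v8 row «(J-nc) in-house road» (LEAD DESK WORDS T8-28 (1) ∕ T8-31 (1) ∕ T8-36, F0P3a-plan (g9), 2026-09-01); author F0P3a-p06 (g10).  Companion of ★ (d3a)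
`ArchLocalWallAveraging` (the identity `F_Θ(z) = c₀ · Orb_{G₂}(f♭)(d₂ z)`): here the regularity of `f♭` that the rank-one limit formula on the group ((R1G), ★ p840625
`exists_tendsto_deriv_two_sin_smul_orbitalIntegral_of_chart_identity`: `ContDiff ℝ 1 f`, `HasCompactSupport f` on `Matrix (Fin 2) (Fin 2) ℂ`, `L^∞`-operator norms
`open scoped Matrix.Norms.Operator`) asks of its test function.

WHAT IS PROVED.
* §1 GENERIC (`Y` a topological measure space with a locally finite measure finite on compacts, `P` a real normed space, `V` a finite-dimensional real normed space, `Ψ : P × V → ℂ` of class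
  `C¹`, `y : Y → P` continuous, `β ∈ C_c(Y)` real): **`contDiff_one_integral_ofReal_mul_comp`** — `X ↦ ∫ β(t) Ψ(y t, X) dν(t)` is `C¹` on `V` (Mathlib
  `hasFDerivAt_integral_of_dominated_of_fderiv_le` with the bound `sup_{tsupport β × B̄(X₀,1)} ‖D_X‖ · 𝟙_{tsupport β}`, derivative field `β(t) • D Ψ(y t, X) ∘ inr` jointly continuous,
  continuity of the derivative by `continuous_parametric_integral_of_continuous` over the compact `tsupport β`); **`hasCompactSupport_integral_ofReal_mul_comp`** — compact support in `X`
  when `Ψ(y t, ·)` vanishes off a fixed compact for `t ∈ tsupport β`.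
* §2 FOR `G_w = archLocal L 3 (diagonal α) w` (`Θ : Matrix (Fin 3) (Fin 3) ℂ → ℂ`, `D : Matrix (Fin 1) (Fin 1) ℂ`, `β ∈ C_c(G_w)`): `contDiff_endoForm_left` (`X ↦ endoForm X D` is affine:
  a real-linear map plus a constant), `submatrix_endoForm` (the left inverse `(endoForm X D)|_{{0,2}×{0,2}} = X`), **`contDiff_one_averagedTestFunction`** (`Θ ∈ C¹ ⇒ f♭ ∈ C¹`),
  **`hasCompactSupport_averagedTestFunction`** (`Θ` with AMBIENT compact support ⇒ `f♭` compactly supported: `supp f♭ ⊆ (·)|_{block} ((tsupport β)⁻¹ · tsupport Θ · (tsupport β))`).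
HONEST LABEL: calculus bookkeeping; HC_CM is proved only modulo the printed citations until rung 0 closes and this file pays nothing by itself.

## References
* [Folland1995] G. B. Folland, *Real Analysis* ∕ *A Course in Abstract Harmonic Analysis* (1995), Thm. 2.27 (differentiation under the integral sign), §2.6.
* [Rogawski1990] J. D. Rogawski, *Automorphic Representations of Unitary Groups in Three Variables*, Ann. of Math. Stud. 123 (1990), §8.2 p. 123, §4.8 Case (a) p. 53.
-/

set_option autoImplicit false

noncomputable section

open MeasureTheory Measure NumberField NumberField.InfinitePlace Filter Topology
open Literature.NumberTheory.Rogawski1990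
open scoped MatrixGroups Matrix.Norms.Operator

namespace Literature.NumberTheory.Automorphic

/-! ## §1 Generic: `X ↦ ∫ β(t) Ψ(y t, X) dν(t)` is `C¹` with compact support -/

section Generic

variable {Y : Type*} [TopologicalSpace Y] [T2Space Y] [MeasurableSpace Y] [OpensMeasurableSpace Y]
  {P : Type*} [NormedAddCommGroup P] [NormedSpace ℝ P]
  {V : Type*} [NormedAddCommGroup V] [NormedSpace ℝ V] [FiniteDimensional ℝ V]

/-- **DIFFERENTIATION UNDER THE INTEGRAL SIGN, `C¹` VERSION WITH A COMPACTLY SUPPORTED WEIGHT**: for `Ψ : P × V → ℂ` of class `C¹`, `y : Y → P` continuous and `β ∈ C_c(Y)`,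
`X ↦ ∫ β(t) Ψ(y t, X) dν(t)` is `C¹` on the finite-dimensional space `V`. [cite: Folland1995, Thm. 2.27] -/
theorem contDiff_one_integral_ofReal_mul_comp (ν : Measure Y) [IsLocallyFiniteMeasure ν] [IsFiniteMeasureOnCompacts ν]
    (Ψ : P × V → ℂ) (hΨ : ContDiff ℝ 1 Ψ) (y : Y → P) (hy : Continuous y) (β : Y → ℝ) (hβ : Continuous β) (hβs : HasCompactSupport β) :
    ContDiff ℝ 1 fun X : V => ∫ t, (β t : ℂ) * Ψ (y t, X) ∂ν := by
  -- the derivative field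
  obtain ⟨Φ', hΦ'⟩ : ∃ Φ' : Y → V → (V →L[ℝ] ℂ), Φ' = fun t X => (β t : ℂ) • (fderiv ℝ Ψ (y t, X)).comp (ContinuousLinearMap.inr ℝ P V) := ⟨_, rfl⟩
  have hderiv : ∀ t X, HasFDerivAt (fun X : V => (β t : ℂ) * Ψ (y t, X)) (Φ' t X) X := fun t X => by
    rw [hΦ']
    exact (((hΨ.differentiable one_ne_zero) (y t, X)).hasFDerivAt.comp X (hasFDerivAt_prodMk_right (y t) X)).const_mul (β t : ℂ)
  have hΦ'c : Continuous (Function.uncurry fun (X : V) (t : Y) => Φ' t X) := by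
    rw [hΦ']
    exact (Complex.continuous_ofReal.comp (hβ.comp continuous_snd)).smul
      ((((hΨ.continuous_fderiv one_ne_zero).comp ((hy.comp continuous_snd).prodMk continuous_fst))).clm_comp continuous_const)
  have hΦ'0 : ∀ X, ∀ t ∉ tsupport β, Φ' t X = 0 := fun X t ht => by
    simp only [hΦ', image_eq_zero_of_notMem_tsupport ht, Complex.ofReal_zero]
    exact zero_smul ℂ ((fderiv ℝ Ψ (y t, X)).comp (ContinuousLinearMap.inr ℝ P V))
  have hK : IsCompact (tsupport β) := hβs
  have hcontX : ∀ X, Continuous fun t => (β t : ℂ) * Ψ (y t, X) := fun X =>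
    (Complex.continuous_ofReal.comp hβ).mul (hΨ.continuous.comp (hy.prodMk continuous_const))
  -- differentiation under the integral sign at every point
  have hmain : ∀ X₀ : V, HasFDerivAt (fun X : V => ∫ t, (β t : ℂ) * Ψ (y t, X) ∂ν) (∫ t, Φ' t X₀ ∂ν) X₀ := by
    intro X₀
    obtain ⟨M, hM⟩ := (hK.prod (isCompact_closedBall X₀ 1)).bddAbove_image
      (f := fun p : Y × V => ‖Φ' p.1 p.2‖) ((hΦ'c.comp (continuous_snd.prodMk continuous_fst)).norm.continuousOn)
    refine hasFDerivAt_integral_of_dominated_of_fderiv_le (F := fun (X : V) (t : Y) => (β t : ℂ) * Ψ (y t, X))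
      (F' := fun (X : V) (t : Y) => Φ' t X) (bound := (tsupport β).indicator fun _ => M) (Metric.ball_mem_nhds X₀ zero_lt_one) ?_ ?_ ?_ ?_ ?_ ?_
    · exact Eventually.of_forall fun X => (hcontX X).aestronglyMeasurable
    · exact (hcontX X₀).integrable_of_hasCompactSupport ((hβs.comp_left Complex.ofReal_zero).mul_right)
    · exact (hΦ'c.comp (continuous_const.prodMk continuous_id)).aestronglyMeasurable
    · refine Eventually.of_forall fun t X hX => ?_
      by_cases ht : t ∈ tsupport β
      · rw [Set.indicator_of_mem ht]
        exact mem_upperBounds.mp hM _ ⟨(t, X), ⟨ht, Metric.ball_subset_closedBall hX⟩, rfl⟩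
      · simp only [hΦ'0 X t ht, norm_zero, Set.indicator_of_notMem ht, le_refl]
    · exact (integrable_indicator_iff hK.measurableSet).mpr ((integrableOn_const_iff).mpr (Or.inr hK.measure_lt_top))
    · exact Eventually.of_forall fun t X _ => hderiv t X
  -- assemble: differentiable with continuous derivative
  rw [contDiff_one_iff_fderiv]
  refine ⟨fun X => (hmain X).differentiableAt, ?_⟩
  have hfd : (fderiv ℝ fun X : V => ∫ t, (β t : ℂ) * Ψ (y t, X) ∂ν) = fun X => ∫ t in tsupport β, Φ' t X ∂ν := by
    funext X
    rw [(hmain X).fderiv]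
    exact (setIntegral_eq_integral_of_forall_compl_eq_zero fun t ht => hΦ'0 X t ht).symm
  rw [hfd]
  exact continuous_parametric_integral_of_continuous hΦ'c hK

omit [T2Space Y] [MeasurableSpace Y] [OpensMeasurableSpace Y] [NormedAddCommGroup P] [NormedSpace ℝ P] [NormedSpace ℝ V] [FiniteDimensional ℝ V] in
/-- **COMPACT SUPPORT**: if `Ψ(y t, ·)` vanishes off a fixed compact `K` for every `t ∈ tsupport β`, then `X ↦ ∫ β(t) Ψ(y t, X) dν(t)` is supported in `K`.
[cite: Folland1995, §2.6] -/
theorem hasCompactSupport_integral_ofReal_mul_comp [MeasurableSpace Y] (ν : Measure Y) (Ψ : P × V → ℂ) (y : Y → P) (β : Y → ℝ)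
    {K : Set V} (hK : IsCompact K) (h0 : ∀ t ∈ tsupport β, ∀ X ∉ K, Ψ (y t, X) = 0) :
    HasCompactSupport fun X : V => ∫ t, (β t : ℂ) * Ψ (y t, X) ∂ν := by
  refine HasCompactSupport.intro hK fun X hX => ?_
  refine integral_eq_zero_of_ae (Eventually.of_forall fun t => ?_)
  by_cases ht : t ∈ tsupport β
  · simp only [h0 t ht X hX, mul_zero, Pi.zero_apply]
  · simp only [image_eq_zero_of_notMem_tsupport ht, Complex.ofReal_zero, zero_mul, Pi.zero_apply]

end Generic

/-! ## §2 The averaged test function of the wall averaging on `G_w` -/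

namespace UnitaryGroup

section Wall

variable (L : Type) [Field L] (α : Fin 3 → L) (w : {w : InfinitePlace L // IsComplex w})

/-- `X ↦ endoForm X D` is AFFINE (a real-linear map plus the constant `endoForm 0 D`), hence smooth. [cite: Rogawski1990, §4.8 Case (a) p. 53] -/
theorem contDiff_endoForm_left (D : Matrix (Fin 1) (Fin 1) ℂ) {n : WithTop ℕ∞} :
    ContDiff ℝ n fun X : Matrix (Fin 2) (Fin 2) ℂ => endoForm X D := by
  let Λ : Matrix (Fin 2) (Fin 2) ℂ →ₗ[ℝ] Matrix (Fin 3) (Fin 3) ℂ :=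
    { toFun := fun X => endoForm X 0
      map_add' := fun X X' => by
        show endoForm (X + X') 0 = endoForm X 0 + endoForm X' 0
        simp only [endoForm, Matrix.reindex_apply]
        rw [show Matrix.fromBlocks (X + X') (0 : Matrix (Fin 2) (Fin 1) ℂ) (0 : Matrix (Fin 1) (Fin 2) ℂ) (0 : Matrix (Fin 1) (Fin 1) ℂ) =
          Matrix.fromBlocks X 0 0 0 + Matrix.fromBlocks X' 0 0 0 by rw [Matrix.fromBlocks_add]; simp only [add_zero]]
        rfl
      map_smul' := fun c X => by
        show endoForm (c • X) 0 = c • endoForm X 0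
        simp only [endoForm, Matrix.reindex_apply]
        rw [show Matrix.fromBlocks (c • X) (0 : Matrix (Fin 2) (Fin 1) ℂ) (0 : Matrix (Fin 1) (Fin 2) ℂ) (0 : Matrix (Fin 1) (Fin 1) ℂ) =
          c • Matrix.fromBlocks X 0 0 0 by rw [Matrix.fromBlocks_smul]; simp only [smul_zero]]
        rfl }
  have hΛ : (fun X : Matrix (Fin 2) (Fin 2) ℂ => endoForm X D) = fun X => Λ X + endoForm 0 D := by
    funext X
    show endoForm X D = endoForm X 0 + endoForm 0 D
    simp only [endoForm, Matrix.reindex_apply]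
    rw [show Matrix.fromBlocks X (0 : Matrix (Fin 2) (Fin 1) ℂ) (0 : Matrix (Fin 1) (Fin 2) ℂ) D =
      Matrix.fromBlocks X 0 0 0 + Matrix.fromBlocks 0 0 0 D by rw [Matrix.fromBlocks_add]; simp only [add_zero, zero_add]]
    rfl
  rw [hΛ]
  exact (LinearMap.toContinuousLinearMap Λ).contDiff.add contDiff_const

/-- The `{0,2} × {0,2}` block of `endoForm X D` is `X` (a continuous LEFT INVERSE of `X ↦ endoForm X D`). [cite: Rogawski1990, §4.8 Case (a) p. 53] -/
theorem submatrix_endoForm (X : Matrix (Fin 2) (Fin 2) ℂ) (D : Matrix (Fin 1) (Fin 1) ℂ) :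
    (endoForm X D).submatrix ![(0 : Fin 3), 2] ![(0 : Fin 3), 2] = X := by
  rw [endoForm_eq]
  ext i j
  fin_cases i <;> fin_cases j <;> rfl

variable [MeasurableSpace (archLocal L 3 (Matrix.diagonal α) w)] [BorelSpace (archLocal L 3 (Matrix.diagonal α) w)]

/-- **`f♭ ∈ C¹`**: for `Θ : Matrix (Fin 3) (Fin 3) ℂ → ℂ` of class `C¹` (operator norms), `β ∈ C_c(G_w)` and any `D`, the averaged test function
`X ↦ ∫_{G_w} β(g) Θ(↑↑g · endoForm X D · ↑↑g⁻¹) dν(g)` is `C¹` on `Matrix (Fin 2) (Fin 2) ℂ` (§1 with `Ψ((P,Q),X) = Θ(P · endoForm X D · Q)`, jointly `C¹`, and `y(g) = (↑↑g, ↑↑g⁻¹)`).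
[cite: Folland1995, Thm. 2.27] [cite: Rogawski1990, §8.2 p. 123] -/
theorem contDiff_one_averagedTestFunction (ν : Measure (archLocal L 3 (Matrix.diagonal α) w)) [IsLocallyFiniteMeasure ν] [IsFiniteMeasureOnCompacts ν]
    (β : archLocal L 3 (Matrix.diagonal α) w → ℝ) (hβ : Continuous β) (hβs : HasCompactSupport β)
    (Θ : Matrix (Fin 3) (Fin 3) ℂ → ℂ) (hΘ : ContDiff ℝ 1 Θ) (D : Matrix (Fin 1) (Fin 1) ℂ) :
    ContDiff ℝ 1 fun X : Matrix (Fin 2) (Fin 2) ℂ => ∫ g, (β g : ℂ) *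
      Θ (((g : GL (Fin 3) ℂ) : Matrix (Fin 3) (Fin 3) ℂ) * endoForm X D * (((g : GL (Fin 3) ℂ)⁻¹ : GL (Fin 3) ℂ) : Matrix (Fin 3) (Fin 3) ℂ)) ∂ν := by
  have hΨ : ContDiff ℝ 1 fun q : (Matrix (Fin 3) (Fin 3) ℂ × Matrix (Fin 3) (Fin 3) ℂ) × Matrix (Fin 2) (Fin 2) ℂ => Θ (q.1.1 * endoForm q.2 D * q.1.2) :=
    hΘ.comp (((contDiff_fst.comp contDiff_fst).mul ((contDiff_endoForm_left D).comp contDiff_snd)).mul (contDiff_snd.comp contDiff_fst))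
  have hy : Continuous fun g : archLocal L 3 (Matrix.diagonal α) w =>
      ((((g : GL (Fin 3) ℂ) : Matrix (Fin 3) (Fin 3) ℂ)), (((g : GL (Fin 3) ℂ)⁻¹ : GL (Fin 3) ℂ) : Matrix (Fin 3) (Fin 3) ℂ)) :=
    (Units.continuous_val.comp continuous_subtype_val).prodMk (Units.continuous_coe_inv.comp continuous_subtype_val)
  exact contDiff_one_integral_ofReal_mul_comp ν _ hΨ _ hy β hβ hβs

omit [BorelSpace (archLocal L 3 (Matrix.diagonal α) w)] in
/-- **`f♭` HAS COMPACT SUPPORT** when `Θ` has AMBIENT compact support: `f♭(X) ≠ 0` forces `↑↑g · endoForm X D · ↑↑g⁻¹ ∈ tsupport Θ` for some `g ∈ tsupport β`, so `X`, the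
`{0,2} × {0,2}` block of `↑↑g⁻¹ · M · ↑↑g` (`M ∈ tsupport Θ`), lies in a fixed compact. [cite: Folland1995, §2.6] [cite: Rogawski1990, §8.2 p. 123] -/
theorem hasCompactSupport_averagedTestFunction (ν : Measure (archLocal L 3 (Matrix.diagonal α) w))
    (β : archLocal L 3 (Matrix.diagonal α) w → ℝ) (hβs : HasCompactSupport β)
    (Θ : Matrix (Fin 3) (Fin 3) ℂ → ℂ) (hΘs : HasCompactSupport Θ) (D : Matrix (Fin 1) (Fin 1) ℂ) :
    HasCompactSupport fun X : Matrix (Fin 2) (Fin 2) ℂ => ∫ g, (β g : ℂ) *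
      Θ (((g : GL (Fin 3) ℂ) : Matrix (Fin 3) (Fin 3) ℂ) * endoForm X D * (((g : GL (Fin 3) ℂ)⁻¹ : GL (Fin 3) ℂ) : Matrix (Fin 3) (Fin 3) ℂ)) ∂ν := by
  -- the compact: the block of `↑↑g⁻¹ · M · ↑↑g`, `(M, g) ∈ tsupport Θ × tsupport β`
  have hc : Continuous fun p : Matrix (Fin 3) (Fin 3) ℂ × archLocal L 3 (Matrix.diagonal α) w =>
      ((((p.2 : GL (Fin 3) ℂ)⁻¹ : GL (Fin 3) ℂ) : Matrix (Fin 3) (Fin 3) ℂ) * p.1 * ((p.2 : GL (Fin 3) ℂ) : Matrix (Fin 3) (Fin 3) ℂ)).submatrix ![(0 : Fin 3), 2] ![(0 : Fin 3), 2] :=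
    ((((Units.continuous_coe_inv.comp continuous_subtype_val).comp continuous_snd).matrix_mul continuous_fst).matrix_mul
      ((Units.continuous_val.comp continuous_subtype_val).comp continuous_snd)).matrix_submatrix _ _
  refine hasCompactSupport_integral_ofReal_mul_comp ν
    (fun q : (Matrix (Fin 3) (Fin 3) ℂ × Matrix (Fin 3) (Fin 3) ℂ) × Matrix (Fin 2) (Fin 2) ℂ => Θ (q.1.1 * endoForm q.2 D * q.1.2))
    (fun g : archLocal L 3 (Matrix.diagonal α) w => ((((g : GL (Fin 3) ℂ) : Matrix (Fin 3) (Fin 3) ℂ)), (((g : GL (Fin 3) ℂ)⁻¹ : GL (Fin 3) ℂ) : Matrix (Fin 3) (Fin 3) ℂ)))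
    β ((hΘs.isCompact.prod hβs.isCompact).image hc) fun g hg X hX => ?_
  by_contra hne
  apply hX
  have hM : ((g : GL (Fin 3) ℂ) : Matrix (Fin 3) (Fin 3) ℂ) * endoForm X D * (((g : GL (Fin 3) ℂ)⁻¹ : GL (Fin 3) ℂ) : Matrix (Fin 3) (Fin 3) ℂ) ∈ tsupport Θ :=
    subset_tsupport Θ hne
  refine ⟨(_, g), ⟨hM, hg⟩, ?_⟩
  show ((((g : GL (Fin 3) ℂ)⁻¹ : GL (Fin 3) ℂ) : Matrix (Fin 3) (Fin 3) ℂ) *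
      (((g : GL (Fin 3) ℂ) : Matrix (Fin 3) (Fin 3) ℂ) * endoForm X D * (((g : GL (Fin 3) ℂ)⁻¹ : GL (Fin 3) ℂ) : Matrix (Fin 3) (Fin 3) ℂ)) *
      ((g : GL (Fin 3) ℂ) : Matrix (Fin 3) (Fin 3) ℂ)).submatrix ![(0 : Fin 3), 2] ![(0 : Fin 3), 2] = X
  rw [← mul_assoc, ← mul_assoc, Units.inv_mul, one_mul, mul_assoc, Units.inv_mul, mul_one, submatrix_endoForm]

end Wall

end UnitaryGroup

end Literature.NumberTheory.Automorphic

end
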